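import Summits.HodgeConjecture.HodgeCM.Model.ArchKTypeOfDefinite_1

/-! PORT of `HodgeCM/Model/ArchKTypeOfDefinite.lean` (HodgeCMPerL run 82) — part 2: continuation of `Summits.HodgeConjecture.HodgeCM.Model.ArchKTypeOfDefinite_1` (split at a top-level declaration boundary by port_pkg.py; scope re-opened below; declarations unchanged). -/

-- port_pkg: scope re-opened for this part (file-level context, then the namespace/section stack open at the cut)
set_option autoImplicit false
noncomputable section
open NumberField NumberField.InfinitePlace NumberField.mixedEmbedding IsDedekindDomain
open scoped Matrix TensorProduct Classical SchwartzMap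
open MvPolynomial
open Literature.AlgebraicGeometry.HodgeTheory
open Literature.NumberTheory.Automorphic Literature.NumberTheory.Automorphic.UnitaryGroup Literature.NumberTheory.Weil1964
open Literature.RepresentationTheory.KonnoKonno2007 Literature.RepresentationTheory.KonnoKonno2007.RealDualPair
open Literature.NumberTheory.GelbartRogawski1991 Literature.NumberTheory.GelbartRogawski1991.UnitaryDualPair
open Literature.RepresentationTheory (atPlace)
open Literature.Analysis.SegalBargmann
open HodgeCM.Adelic HodgeCM.PerL34 HodgeCM.Model.HypCensus HodgeCM.Model.SupplyInstance HodgeCM.Model.ArchSideTerm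
namespace HodgeCM.Model
section HarchPin
variable {L : CMField} {ι₁ : L →+* ℂ} (V : HermSpace3 L ι₁) (S : StubTree.SeesawDatum L)
variable
  (hGR : (cmSplittingDatum (L : Type) finProdFinEquiv (frameD V) (frameD_real V) (frameD_ne V) (dW S) (dW_real S) (dW_ne S)).CompatibleSplitting)
  (hGR₀ : (cmSplittingDatum (L : Type) (e₁) (frameD V) (frameD_real V) (frameD_ne V) (lineVec (L : Type) (dW S 0))
    (fun _ => dW_real S 0) (fun _ => dW_ne S 0)).CompatibleSplitting)
  (hGR₁ : (cmSplittingDatum (L : Type) (e₁) (frameD V) (frameD_real V) (frameD_ne V) (lineVec (L : Type) (dW S 1))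
    (fun _ => dW_real S 1) (fun _ => dW_ne S 1)).CompatibleSplitting)
  (hGR₂ : (cmSplittingDatum (L : Type) (e₁) (frameD V) (frameD_real V) (frameD_ne V) (lineVec (L : Type) (dW' S 0))
    (fun _ => dW'_real S 0) (fun _ => dW'_ne S 0)).CompatibleSplitting)
  (hGR₃ : (cmSplittingDatum (L : Type) (e₁) (frameD V) (frameD_real V) (frameD_ne V) (lineVec (L : Type) (dW' S 1))
    (fun _ => dW'_real S 1) (fun _ => dW'_ne S 1)).CompatibleSplitting)
  (η : CMAdelic (L : Type) (frameD V) × CMAdelic (L : Type) (dW S) →* ℂˣ)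
  (hV : IsAnisotropic L V.Hm)
variable {S' : Type} [Fintype S'] [DecidableEq S']
  (eR : PosIdx (cmXW (L : Type) (frameD V) (lineVec (L : Type) (dW S 0)) (fun _ => dW_real S 0) ι₁ (HypCensus.cmPlace (L : Type) ι₁)) ≃ Unit)
  (eS : NegIdx (cmXW (L : Type) (frameD V) (lineVec (L : Type) (dW S 0)) (fun _ => dW_real S 0) ι₁ (HypCensus.cmPlace (L : Type) ι₁)) ≃ S')
/-- **(c5) FOR LINE 0 FROM THE DEFINITE TYPE OF THE LINE SCALAR.**  If at every real place `b ≠ v₁` the line-0 scalar `c₀ = η₀·χ₀` kills the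
vacuum exponent of the pair `(diag frameD V, ⟨a₀⟩)` there (`c₀((archSingle (w b) u)) · det(u)^{a b} = 1`, with `a` the exponent function of
`exists_defExponent_blockFamilyOfAt`, supplied as the hypothesis `hω`), then every archimedean `aa ∈ U(V.Hm)(L ⊗ ℝ)` with trivial
`w(ι₁)`-component fixes every `φ_N(Φarch ℓ)` under `lineRepD … 0` — LITERALLY the `harch` input of the row-12 term (#CA13–#CA19) for line 0. -/
theorem harch_zero_of_defType (x₀ : Fin 3 → ↥(maximalRealSubfield L)) (N : ℕ)
    (a : {v : InfinitePlace ↥(maximalRealSubfield L) // v.IsReal} → ℤ)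
    (hω : ∀ b : {v : InfinitePlace ↥(maximalRealSubfield L) // v.IsReal}, b ≠ HypCensus.cmPlace (L : Type) ι₁ →
      ∀ (u : UnitaryGroup.archLocal (L : Type) 3 (Matrix.diagonal (frameD V)) (cmPlaceOver (L : Type) b)) (ℓ : Module.Dual ℂ (Fin 2 → ℂ)),
        cmArchWeilRep (L : Type) e₁ (frameD V) (frameD_real V) (frameD_ne V) (lineVec (L : Type) (dW S 0)) (fun _ => dW_real S 0)
            (fun _ => dW_ne S 0) hGR₀
            (UnitaryGroup.archSingle (↥(maximalRealSubfield L)) L (IsCMField.complexConj L) 3 (Matrix.diagonal (frameD V))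
              (IsCMField.complexConj_ne_one L) (NumberField.complexConj_smul_infinitePlace (L : Type)) (cmPlaceOver (L : Type) b) u, 1)
            (blockFamilyOfAt (L : Type) e₁ (frameD V) (frameD_real V) (frameD_ne V) (lineVec (L : Type) (dW S 0)) (fun _ => dW_real S 0)
              (fun _ => dW_ne S 0) ι₁ (blockPosEquiv V) (blockNegEquiv V) eR eS (degOnePDual S') (binvPi 1) ℓ) =
          (((u : UnitaryGroup.archLocal (L : Type) 3 (Matrix.diagonal (frameD V)) (cmPlaceOver (L : Type) b)) : GL (Fin 3) ℂ) :
              Matrix (Fin 3) (Fin 3) ℂ).det ^ a b •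
            blockFamilyOfAt (L : Type) e₁ (frameD V) (frameD_real V) (frameD_ne V) (lineVec (L : Type) (dW S 0)) (fun _ => dW_real S 0)
              (fun _ => dW_ne S 0) ι₁ (blockPosEquiv V) (blockNegEquiv V) eR eS (degOnePDual S') (binvPi 1) ℓ)
    (hdef : ∀ b : {v : InfinitePlace ↥(maximalRealSubfield L) // v.IsReal}, b ≠ HypCensus.cmPlace (L : Type) ι₁ →
      ∀ u : UnitaryGroup.archLocal (L : Type) 3 (Matrix.diagonal (frameD V)) (cmPlaceOver (L : Type) b),
        ((archScalar_zero V S hGR hGR₀ hGR₁ η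
            (UnitaryGroup.archSingle (↥(maximalRealSubfield L)) L (IsCMField.complexConj L) 3 (Matrix.diagonal (frameD V))
              (IsCMField.complexConj_ne_one L) (NumberField.complexConj_smul_infinitePlace (L : Type)) (cmPlaceOver (L : Type) b) u) : ℂˣ) : ℂ) *
          (((u : UnitaryGroup.archLocal (L : Type) 3 (Matrix.diagonal (frameD V)) (cmPlaceOver (L : Type) b)) : GL (Fin 3) ℂ) :
              Matrix (Fin 3) (Fin 3) ℂ).det ^ a b = 1) :
    ∀ aa : UnitaryGroup.arch (↥(maximalRealSubfield L)) L (IsCMField.complexConj L) 3 V.Hm,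
      UnitaryGroup.archAt (↥(maximalRealSubfield L)) L (IsCMField.complexConj L) 3 V.Hm (UnitaryGroup.cmPlace (L : Type) ι₁)
          (NumberField.complexConj_smul_infinitePlace (L : Type) _) (IsCMField.complexConj_ne_one (L : Type)) aa = 1 →
      ∀ ℓ : Module.Dual ℂ (Fin 2 → ℂ),
        lineRepD V S hGR hGR₀ hGR₁ hGR₂ hGR₃ η 0
            (HodgeCM.Adelic.regimeEquiv L V.Hm hV
              (UnitaryGroup.archToAdelic (↥(maximalRealSubfield L)) L (IsCMField.complexConj L) 3 V.Hm aa), 1)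
            (testFun (↥(maximalRealSubfield L)) (Fin 3)
              (blockFamilyOfAt (L : Type) e₁ (frameD V) (frameD_real V) (frameD_ne V) (lineVec (L : Type) (dW S 0)) (fun _ => dW_real S 0)
                (fun _ => dW_ne S 0) ι₁ (blockPosEquiv V) (blockNegEquiv V) eR eS (degOnePDual S') (binvPi 1) ℓ) x₀ N) =
          testFun (↥(maximalRealSubfield L)) (Fin 3)
            (blockFamilyOfAt (L : Type) e₁ (frameD V) (frameD_real V) (frameD_ne V) (lineVec (L : Type) (dW S 0)) (fun _ => dW_real S 0)
              (fun _ => dW_ne S 0) ι₁ (blockPosEquiv V) (blockNegEquiv V) eR eS (degOnePDual S') (binvPi 1) ℓ) x₀ N := by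
  intro aa haa ℓ
  rw [apply_testFun_of_eq_adelicTensorEnd (lineRepD_zero_regime_archToAdelic V S hGR hGR₀ hGR₁ hGR₂ hGR₃ η hV aa) _ x₀ N,
    LinearMap.smul_apply]
  congr 1
  have h := smul_apply_eq_self_of_places (L : Type) (Matrix.diagonal (frameD V))
    ((cmArchWeilRep (L : Type) e₁ (frameD V) (frameD_real V) (frameD_ne V) (lineVec (L : Type) (dW S 0)) (fun _ => dW_real S 0)
      (fun _ => dW_ne S 0) hGR₀).comp (MonoidHom.inl _ _))
    (archScalar_zero V S hGR hGR₀ hGR₁ η)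
    (blockFamilyOfAt (L : Type) e₁ (frameD V) (frameD_real V) (frameD_ne V) (lineVec (L : Type) (dW S 0)) (fun _ => dW_real S 0)
      (fun _ => dW_ne S 0) ι₁ (blockPosEquiv V) (blockNegEquiv V) eR eS (degOnePDual S') (binvPi 1) ℓ)
    (UnitaryGroup.cmPlace (L : Type) ι₁) (fun b hb u => by
      rw [MonoidHom.comp_apply, MonoidHom.inl_apply, hω b (ne_cmPlace_of_cmPlaceOver_ne hb) u ℓ, smul_smul,
        hdef b (ne_cmPlace_of_cmPlaceOver_ne hb) u, one_smul])
    (archFrameCongr (L : Type) V.Hm (frameG V) (frameD V) (frame_congr V) aa) (archAt_archFrameCongr_eq_one V haa)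
  rw [MonoidHom.comp_apply, MonoidHom.inl_apply] at h
  exact h


/-! ### line 1 -/

/-- **the scalar of line 1 on archimedean elements of `U(diag frameD V)`**: `x ↦ η₁(x^𝔸, 1) · χ₁(x^𝔸, 1)` (its pull-back along the
`ι₁`-section `archSectionFrameOf V` is #CA3's `lineScalar_one`). -/
def archScalar_one : UnitaryGroup.arch (↥(maximalRealSubfield L)) L (IsCMField.complexConj L) 3 (Matrix.diagonal (frameD V)) →* ℂˣ :=
  ((eta₁ V S η).comp (MonoidHom.prod
      (UnitaryGroup.archToAdelic (↥(maximalRealSubfield L)) L (IsCMField.complexConj L) 3 (Matrix.diagonal (frameD V))) 1)) *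
    ((cmLineChar₁ (L : Type) finProdFinEquiv e₁ (frameD V) (frameD_real V) (frameD_ne V) (dW S) (dW_real S) (dW_ne S) hGR hGR₀ hGR₁).comp
      (MonoidHom.prod (UnitaryGroup.archToAdelic (↥(maximalRealSubfield L)) L (IsCMField.complexConj L) 3 (Matrix.diagonal (frameD V))) 1))

/-- (Ported verbatim from the HodgeCMPerL package; no docstring in the source.) -/
theorem archScalar_one_apply (x : UnitaryGroup.arch (↥(maximalRealSubfield L)) L (IsCMField.complexConj L) 3 (Matrix.diagonal (frameD V))) :
    archScalar_one V S hGR hGR₀ hGR₁ η x =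
      eta₁ V S η (UnitaryGroup.archToAdelic (↥(maximalRealSubfield L)) L (IsCMField.complexConj L) 3 (Matrix.diagonal (frameD V)) x, 1) *
        cmLineChar₁ (L : Type) finProdFinEquiv e₁ (frameD V) (frameD_real V) (frameD_ne V) (dW S) (dW_real S) (dW_ne S) hGR hGR₀ hGR₁
          (UnitaryGroup.archToAdelic (↥(maximalRealSubfield L)) L (IsCMField.complexConj L) 3 (Matrix.diagonal (frameD V)) x, 1) :=
  rfl

/-- **line 1 at an ARCHIMEDEAN regime element**: `lineRepD 0 ((a)^𝔸, 1) = (c₁(a′) • ω_∞((a′, 1))) ⊗ 1`, `a′ = archFrameCongr (frameG V) a`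
(#CA2 `smul_cmPairRep_archToAdelic_eq_adelicTensorEnd` + the line collapse, as in #CA3 for the `ι₁`-section). -/
theorem lineRepD_one_regime_archToAdelic (a : UnitaryGroup.arch (↥(maximalRealSubfield L)) L (IsCMField.complexConj L) 3 V.Hm) :
    lineRepD V S hGR hGR₀ hGR₁ hGR₂ hGR₃ η 1
        (HodgeCM.Adelic.regimeEquiv L V.Hm hV
          (UnitaryGroup.archToAdelic (↥(maximalRealSubfield L)) L (IsCMField.complexConj L) 3 V.Hm a), 1) =
      adelicTensorEnd
        (((archScalar_one V S hGR hGR₀ hGR₁ η (archFrameCongr (L : Type) V.Hm (frameG V) (frameD V) (frame_congr V) a) : ℂˣ) : ℂ) •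
          (cmArchWeilRep (L : Type) e₁ (frameD V) (frameD_real V) (frameD_ne V) (lineVec (L : Type) (dW S 1))
            (fun _ => dW_real S 1) (fun _ => dW_ne S 1) hGR₁ (archFrameCongr (L : Type) V.Hm (frameG V) (frameD V) (frame_congr V) a, 1) :
              𝓢((Fin 3 → mixedSpace (↥(maximalRealSubfield L))), ℂ) →ₗ[ℂ] _))
        LinearMap.id := by
  have h1 : lineRepD V S hGR hGR₀ hGR₁ hGR₂ hGR₃ η 1
        (HodgeCM.Adelic.regimeEquiv L V.Hm hV
          (UnitaryGroup.archToAdelic (↥(maximalRealSubfield L)) L (IsCMField.complexConj L) 3 V.Hm a), 1) =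
      cmLineRepFin₁ (L : Type) finProdFinEquiv e₁ (frameD V) (frameD_real V) (frameD_ne V) (dW S) (dW_real S) (dW_ne S)
        hGR hGR₀ hGR₁ (eta₁ V S η)
        (UnitaryGroup.archToAdelic (↥(maximalRealSubfield L)) L (IsCMField.complexConj L) 3 (Matrix.diagonal (frameD V))
          (archFrameCongr (L : Type) V.Hm (frameG V) (frameD V) (frame_congr V) a), 1) := by
    rw [← cmFrameEquiv_regime_archToAdelic V hV a]
    rfl
  have key := smul_cmPairRep_archToAdelic_eq_adelicTensorEnd (L : Type) e₁ (frameD V) (frameD_real V) (frameD_ne V)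
    (lineVec (L : Type) (dW S 1)) (fun _ => dW_real S 1) (fun _ => dW_ne S 1) hGR₁
    ((archScalar_one V S hGR hGR₀ hGR₁ η (archFrameCongr (L : Type) V.Hm (frameG V) (frameD V) (frame_congr V) a) : ℂˣ) : ℂ)
    (archFrameCongr (L : Type) V.Hm (frameG V) (frameD V) (frame_congr V) a) 1
  rw [map_one] at key
  rw [h1, ← key]
  refine LinearMap.ext fun φ => ?_
  rw [cmLineRepFin₁_apply_eq_smul_cmPairRep, LinearMap.smul_apply, map_one, map_one]
  rfl

variable
  (eR₁ : PosIdx (cmXW (L : Type) (frameD V) (lineVec (L : Type) (dW S 1)) (fun _ => dW_real S 1) ι₁ (HypCensus.cmPlace (L : Type) ι₁)) ≃ Unit)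
  (eS₁ : NegIdx (cmXW (L : Type) (frameD V) (lineVec (L : Type) (dW S 1)) (fun _ => dW_real S 1) ι₁ (HypCensus.cmPlace (L : Type) ι₁)) ≃ S')

/-- **(c5) FOR LINE 1 FROM THE DEFINITE TYPE OF THE LINE SCALAR.**  If at every real place `b ≠ v₁` the line-1 scalar `c₁ = η₁·χ₁` kills the
vacuum exponent of the pair `(diag frameD V, ⟨a₁⟩)` there (`c₁((archSingle (w b) u)) · det(u)^{a b} = 1`, with `a` the exponent function of
`exists_defExponent_blockFamilyOfAt`, supplied as the hypothesis `hω`), then every archimedean `aa ∈ U(V.Hm)(L ⊗ ℝ)` with trivial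
`w(ι₁)`-component fixes every `φ_N(Φarch ℓ)` under `lineRepD … 0` — LITERALLY the `harch` input of the row-12 term (#CA13–#CA19) for line 1. -/
theorem harch_one_of_defType (x₀ : Fin 3 → ↥(maximalRealSubfield L)) (N : ℕ)
    (a : {v : InfinitePlace ↥(maximalRealSubfield L) // v.IsReal} → ℤ)
    (hω : ∀ b : {v : InfinitePlace ↥(maximalRealSubfield L) // v.IsReal}, b ≠ HypCensus.cmPlace (L : Type) ι₁ →
      ∀ (u : UnitaryGroup.archLocal (L : Type) 3 (Matrix.diagonal (frameD V)) (cmPlaceOver (L : Type) b)) (ℓ : Module.Dual ℂ (Fin 2 → ℂ)),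
        cmArchWeilRep (L : Type) e₁ (frameD V) (frameD_real V) (frameD_ne V) (lineVec (L : Type) (dW S 1)) (fun _ => dW_real S 1)
            (fun _ => dW_ne S 1) hGR₁
            (UnitaryGroup.archSingle (↥(maximalRealSubfield L)) L (IsCMField.complexConj L) 3 (Matrix.diagonal (frameD V))
              (IsCMField.complexConj_ne_one L) (NumberField.complexConj_smul_infinitePlace (L : Type)) (cmPlaceOver (L : Type) b) u, 1)
            (blockFamilyOfAt (L : Type) e₁ (frameD V) (frameD_real V) (frameD_ne V) (lineVec (L : Type) (dW S 1)) (fun _ => dW_real S 1)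
              (fun _ => dW_ne S 1) ι₁ (blockPosEquiv V) (blockNegEquiv V) eR₁ eS₁ (degOnePDual S') (binvPi 1) ℓ) =
          (((u : UnitaryGroup.archLocal (L : Type) 3 (Matrix.diagonal (frameD V)) (cmPlaceOver (L : Type) b)) : GL (Fin 3) ℂ) :
              Matrix (Fin 3) (Fin 3) ℂ).det ^ a b •
            blockFamilyOfAt (L : Type) e₁ (frameD V) (frameD_real V) (frameD_ne V) (lineVec (L : Type) (dW S 1)) (fun _ => dW_real S 1)
              (fun _ => dW_ne S 1) ι₁ (blockPosEquiv V) (blockNegEquiv V) eR₁ eS₁ (degOnePDual S') (binvPi 1) ℓ)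
    (hdef : ∀ b : {v : InfinitePlace ↥(maximalRealSubfield L) // v.IsReal}, b ≠ HypCensus.cmPlace (L : Type) ι₁ →
      ∀ u : UnitaryGroup.archLocal (L : Type) 3 (Matrix.diagonal (frameD V)) (cmPlaceOver (L : Type) b),
        ((archScalar_one V S hGR hGR₀ hGR₁ η
            (UnitaryGroup.archSingle (↥(maximalRealSubfield L)) L (IsCMField.complexConj L) 3 (Matrix.diagonal (frameD V))
              (IsCMField.complexConj_ne_one L) (NumberField.complexConj_smul_infinitePlace (L : Type)) (cmPlaceOver (L : Type) b) u) : ℂˣ) : ℂ) *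
          (((u : UnitaryGroup.archLocal (L : Type) 3 (Matrix.diagonal (frameD V)) (cmPlaceOver (L : Type) b)) : GL (Fin 3) ℂ) :
              Matrix (Fin 3) (Fin 3) ℂ).det ^ a b = 1) :
    ∀ aa : UnitaryGroup.arch (↥(maximalRealSubfield L)) L (IsCMField.complexConj L) 3 V.Hm,
      UnitaryGroup.archAt (↥(maximalRealSubfield L)) L (IsCMField.complexConj L) 3 V.Hm (UnitaryGroup.cmPlace (L : Type) ι₁)
          (NumberField.complexConj_smul_infinitePlace (L : Type) _) (IsCMField.complexConj_ne_one (L : Type)) aa = 1 →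
      ∀ ℓ : Module.Dual ℂ (Fin 2 → ℂ),
        lineRepD V S hGR hGR₀ hGR₁ hGR₂ hGR₃ η 1
            (HodgeCM.Adelic.regimeEquiv L V.Hm hV
              (UnitaryGroup.archToAdelic (↥(maximalRealSubfield L)) L (IsCMField.complexConj L) 3 V.Hm aa), 1)
            (testFun (↥(maximalRealSubfield L)) (Fin 3)
              (blockFamilyOfAt (L : Type) e₁ (frameD V) (frameD_real V) (frameD_ne V) (lineVec (L : Type) (dW S 1)) (fun _ => dW_real S 1)
                (fun _ => dW_ne S 1) ι₁ (blockPosEquiv V) (blockNegEquiv V) eR₁ eS₁ (degOnePDual S') (binvPi 1) ℓ) x₀ N) =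
          testFun (↥(maximalRealSubfield L)) (Fin 3)
            (blockFamilyOfAt (L : Type) e₁ (frameD V) (frameD_real V) (frameD_ne V) (lineVec (L : Type) (dW S 1)) (fun _ => dW_real S 1)
              (fun _ => dW_ne S 1) ι₁ (blockPosEquiv V) (blockNegEquiv V) eR₁ eS₁ (degOnePDual S') (binvPi 1) ℓ) x₀ N := by
  intro aa haa ℓ
  rw [apply_testFun_of_eq_adelicTensorEnd (lineRepD_one_regime_archToAdelic V S hGR hGR₀ hGR₁ hGR₂ hGR₃ η hV aa) _ x₀ N,
    LinearMap.smul_apply]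
  congr 1
  have h := smul_apply_eq_self_of_places (L : Type) (Matrix.diagonal (frameD V))
    ((cmArchWeilRep (L : Type) e₁ (frameD V) (frameD_real V) (frameD_ne V) (lineVec (L : Type) (dW S 1)) (fun _ => dW_real S 1)
      (fun _ => dW_ne S 1) hGR₁).comp (MonoidHom.inl _ _))
    (archScalar_one V S hGR hGR₀ hGR₁ η)
    (blockFamilyOfAt (L : Type) e₁ (frameD V) (frameD_real V) (frameD_ne V) (lineVec (L : Type) (dW S 1)) (fun _ => dW_real S 1)
      (fun _ => dW_ne S 1) ι₁ (blockPosEquiv V) (blockNegEquiv V) eR₁ eS₁ (degOnePDual S') (binvPi 1) ℓ)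
    (UnitaryGroup.cmPlace (L : Type) ι₁) (fun b hb u => by
      rw [MonoidHom.comp_apply, MonoidHom.inl_apply, hω b (ne_cmPlace_of_cmPlaceOver_ne hb) u ℓ, smul_smul,
        hdef b (ne_cmPlace_of_cmPlaceOver_ne hb) u, one_smul])
    (archFrameCongr (L : Type) V.Hm (frameG V) (frameD V) (frame_congr V) aa) (archAt_archFrameCongr_eq_one V haa)
  rw [MonoidHom.comp_apply, MonoidHom.inl_apply] at h
  exact h

end HarchPin

end HodgeCM.Model

end
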